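import Literature.NumberTheory.Sieve.LinearEquationsInPrimesCrudeBounds
import Mathlib.Algebra.BigOperators.Fin
import Mathlib.Data.Fin.Tuple.Basic
import HarnessLib

/-!
# Linear equations in primes: sub-systems with one form deleted

Elementary API for passing from a system `Ψ = (ψ₀, …, ψ_t)` of affine-linear forms
(`Literature/NumberTheory/Sieve/LinearEquationsInPrimes`, Green–Tao 2010, Def. 1.1) to the
sub-system `Ψ₋ᵢ = Fin.removeNth i Ψ` with the `i`-th form deleted, over the HALF-BODY
`K ∩ {ψ_i > 0}` — the shape in which induction on the number of forms is run (a coordinate section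
of the joint prime/rough-cell count of `Ψ` over `K` is a count for `Ψ₋ᵢ` over `K ∩ {ψ_i > 0}`):

* `affLinSize_removeNth_le` — `‖Ψ₋ᵢ‖_N ≤ ‖Ψ‖_N` (eq. (1.1) is a sum of non-negative terms over the
  forms);
* `inter_setOf_realEval_pos_eq` —
  `(K ∩ {ψ_i > 0}) ∩ {ψ_{i.succAbove k} > 0 ∀ k} = K ∩ {ψ_k > 0 ∀ k}`, whence
  `archFactor_removeNth_inter` — `β_∞(Ψ₋ᵢ, K ∩ {ψ_i > 0}) = β_∞(Ψ, K)` (eq. (1.4): same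
  positivity region);
* `convex_inter_realEval_pos` — the half-body is convex (with `AffLinForm.convex_realEval_gt` of
  `LinearEquationsInPrimesCrudeBounds`), `archFactor_nonneg`.

Non-degeneracy of `Ψ₋ᵢ` (immediate from `Fin.succAbove_right_injective`) is not repeated here.
Everything is proved.

References: B. Green, T. Tao, *Linear equations in primes*, Ann. of Math. (2) 171 (2010),
Def. 1.1, (1.1), (1.4), and §4 ("we may intersect `K` with the convex set `Ψ⁻¹((ℝ⁺)ᵗ)`")
[GreenTao2010].
-/

noncomputable section

open Finset MeasureTheory

namespace Literature.NumberTheory.Sieve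

variable {d t : ℕ}

/-- `‖Ψ₋ᵢ‖_N ≤ ‖Ψ‖_N`: deleting a form drops non-negative terms from the size (1.1).
[cite: GreenTao2010, (1.1)] -/
theorem affLinSize_removeNth_le (Ψ : Fin (t + 1) → AffLinForm d) (i : Fin (t + 1)) (N : ℝ) :
    affLinSize (Fin.removeNth i Ψ) N ≤ affLinSize Ψ N := by
  unfold affLinSize
  rw [Fin.sum_univ_succAbove (fun k => ∑ j, |((Ψ k).coeff j : ℝ)|) i,
    Fin.sum_univ_succAbove (fun k => |((Ψ k).const : ℝ) / N|) i]
  simp only [Fin.removeNth_apply]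
  have h1 : 0 ≤ ∑ j, |((Ψ i).coeff j : ℝ)| := Finset.sum_nonneg fun _ _ => abs_nonneg _
  have h2 : 0 ≤ |((Ψ i).const : ℝ) / N| := abs_nonneg _
  linarith

/-- The positivity region of `Ψ` inside `K` is the positivity region of `Ψ₋ᵢ` inside the
half-body `K ∩ {ψ_i > 0}` (split `∀ k : Fin (t+1)` at `i` and along `i.succAbove`). [folklore] -/
theorem inter_setOf_realEval_pos_eq (Ψ : Fin (t + 1) → AffLinForm d) (K : Set (Fin d → ℝ))
    (i : Fin (t + 1)) :
    K ∩ {x | 0 < (Ψ i).realEval x} ∩ {x | ∀ k, 0 < (Fin.removeNth i Ψ k).realEval x} =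
      K ∩ {x | ∀ k, 0 < (Ψ k).realEval x} := by
  ext x
  simp only [Set.mem_inter_iff, Set.mem_setOf_eq, Fin.removeNth_apply]
  rw [Fin.forall_iff_succAbove i, and_assoc]

/-- `β_∞(Ψ₋ᵢ, K ∩ {ψ_i > 0}) = β_∞(Ψ, K)`: the archimedean factor (1.4) of the sub-system over
the half-body is that of the system over the body (same positivity region).
[cite: GreenTao2010, (1.4)] -/
theorem archFactor_removeNth_inter (Ψ : Fin (t + 1) → AffLinForm d) (K : Set (Fin d → ℝ))
    (i : Fin (t + 1)) :
    archFactor (Fin.removeNth i Ψ) (K ∩ {x | 0 < (Ψ i).realEval x}) = archFactor Ψ K := by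
  unfold archFactor
  rw [inter_setOf_realEval_pos_eq]

/-- The half-body `K ∩ {ψ > 0}` of a convex body is convex ("we may intersect `K` with the
convex set `Ψ⁻¹((ℝ⁺)ᵗ)`"). [cite: GreenTao2010, §4 (Elimination of the archimedean factor)] -/
theorem convex_inter_realEval_pos (ψ : AffLinForm d) {K : Set (Fin d → ℝ)} (hK : Convex ℝ K) :
    Convex ℝ (K ∩ {x | 0 < ψ.realEval x}) :=
  hK.inter (ψ.convex_realEval_gt 0)

/-- `β_∞ ≥ 0` (it is the real part of a measure). [folklore] -/
theorem archFactor_nonneg (Ψ : Fin t → AffLinForm d) (K : Set (Fin d → ℝ)) : 0 ≤ archFactor Ψ K :=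
  ENNReal.toReal_nonneg

end Literature.NumberTheory.Sieve

end
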